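import Summits.ValiantsHypothesis.ValiantsHypothesis.Theorems.BarrierLeverPartitionMinorsHitByVPSplittableClasses
import Summits.ValiantsHypothesis.ValiantsHypothesis.Theorems.BarrierLeverPartitionMinorsHitByVPOrProjections

/-!
# Route BarrierLever — item `PartitionMinorsHitByVP` (stmt-ValiantsHypothesis-19717):
# the subset-sum engine beyond faces — SPLITTABLE rows × COORDINATE-HALVABLE columns

Helper file (`--supports stmt-ValiantsHypothesis-19717`; cell valiant-natproofs, rung V4, 𝒟-side door (c),
prover seat val-np-p1 gen 9). Closes NO item. Generalises the engine `SubsetSum.det_ssv_ne_zero`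
(`…SubsetSumVandermonde`, columns = a full face) to every column family that HALVES RECURSIVELY BY
COORDINATES, and feeds val-np-p6 g3's door `AdditiveDoor.partitionMinor_hit_of_additive_mem` directly (no
table extension).

* `IsCoordHalvable κ 𝒲` — recursively: some coordinate `c` lies in exactly half of the members of `𝒲`, and
  both `{W ∈ 𝒲 : c ∉ W}` and `{W ∖ c : c ∈ W ∈ 𝒲}` are coordinate-halvable of depth `κ − 1` (depth `0` = one
  set). Faces `[W₀, W₀ ⊔ T]` and, more generally, every coset of a binary linear code (triple-`∆`-closed family,
  `isCoordHalvable_of_symmDiff_closed`) qualify; Hamming balls do not (no coordinate of degree one half) — and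
  indeed the subset-sum witness dies on ball columns against a `2`-face of rows.
* **`det_ssv2_ne_zero`** (engine v2). Rows `u` injective with `IsSplittable κ (image u)` (each node of the halving
  tree has its own affine functional `U ↦ Σ_{k∈U} a_k − t`), columns `w` injective with `IsCoordHalvable κ
  (image w)`: the symbolic matrix `[∏_{c ∈ w j} (X_(c,none) + Σ_{k ∈ u i} X_(c,some k))]_{i,j}` over
  `ℂ[X_(c,none), X_(c,some k) : c < m, k < h]` has nonzero determinant. Proof = the fiber lemma of the face case
  with the column split `c ∉ W | c ∈ W` of the chosen coordinate: specialising the `c`-block of variables to the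
  rows' splitting functional makes the matrix block lower-triangular after reindexing, with diagonal blocks the
  two depth-`κ−1` instances (the second one multiplied by the nonzero diagonal `−t + Σ a`); induction in the
  domain `MvPolynomial _ ℂ`; the variable ring is the same at every depth.
* `exists_table_det_ne_zero` — a NUMERIC table (`MvPolynomial.funext`), literally the hypothesis of
  `partitionMinor_hit_of_additive_mem`; hence **`partitionMinor_hit_of_isSplittable_isCoordHalvable`**: such layouts
  are hit inside `SmallCircuits ℂ (h+h) 5` (`h ≥ 2`), and by `partitionMinor_hit_symm` the mirror. The companion
  `…SubsetSumCoordHalvableClasses` proves that cosets of binary linear codes are coordinate-halvable and derives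
  the unconditional class «code × code» and the `CubeHalving`-conditional «all rows × coordinate-halvable columns».

WHAT THIS IS NOT: nothing for column families without a balanced coordinate (balls, generic down-sets); no proof
of `CubeHalving`; nothing on crux 14610.
-/

set_option linter.dupNamespace false

namespace Summit.ValiantsHypothesis.ValiantsHypothesis.Theorems.BarrierLever.SubsetSum

open Finset MvPolynomial Matrix
open scoped symmDiff

noncomputable section

variable {h m : ℕ}

/-! ## 1. Coordinate-halvable column families -/

/-- `𝒲` HALVES RECURSIVELY BY COORDINATES to depth `κ`: depth `0` means one set; depth `κ + 1` means some
coordinate `c` lies in exactly those members forming a sub-family whose `c`-deleted sets, and whose complement,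
are both coordinate-halvable of depth `κ` (the cardinalities `2^κ` are recorded explicitly). -/
def IsCoordHalvable : ℕ → Finset (Finset (Fin m)) → Prop
  | 0, 𝒲 => 𝒲.card = 1
  | κ + 1, 𝒲 => ∃ c : Fin m,
      (𝒲.filter fun W => c ∉ W).card = 2 ^ κ ∧ ((𝒲.filter fun W => c ∈ W).image fun W => W.erase c).card = 2 ^ κ ∧
      IsCoordHalvable κ (𝒲.filter fun W => c ∉ W) ∧
      IsCoordHalvable κ ((𝒲.filter fun W => c ∈ W).image fun W => W.erase c)

/-! ## 2. The symbolic matrix with a fixed variable ring -/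

/-- The polynomial ring `ℂ[X_(c, none), X_(c, some k) : c < m, k < h]`. -/
abbrev R2 (m h : ℕ) := MvPolynomial (Fin m × Option (Fin h)) ℂ

/-- `lin2 c U = X_(c,none) + Σ_{k ∈ U} X_(c, some k)`. -/
def lin2 (c : Fin m) (U : Finset (Fin h)) : R2 m h := X (c, none) + ∑ k ∈ U, X (c, some k)

/-- `lin2 c U ≠ 0`: the coefficient of `X_(c,none)` is `1`. -/
theorem lin2_ne_zero (c : Fin m) (U : Finset (Fin h)) : lin2 c U ≠ 0 := by
  intro h0
  have h1 : eval (fun p : Fin m × Option (Fin h) => if p = (c, none) then (1 : ℂ) else 0) (lin2 c U) = 1 := by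
    simp [lin2]
  rw [h0, map_zero] at h1
  exact zero_ne_one h1

/-- The symbolic matrix `[∏_{c ∈ w j} lin2 c (u i)]_{i,j}` for row/column families indexed by bit-vectors. -/
def ssv2 (κ : ℕ) (u : (Fin κ → Bool) → Finset (Fin h)) (w : (Fin κ → Bool) → Finset (Fin m)) :
    Matrix (Fin κ → Bool) (Fin κ → Bool) (R2 m h) :=
  fun i j => ∏ c ∈ w j, lin2 c (u i)

/-! ## 3. Specialising one block of variables -/

/-- Substitute the `c₀`-block by the constants of a splitting functional; keep every other variable. -/
def spec2 (c₀ : Fin m) (a : Fin h → ℂ) (t : ℂ) : Fin m × Option (Fin h) → R2 m h :=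
  fun p => if p.1 = c₀ then C (Option.elim p.2 (-t) a) else X p

/-- The specialisation `φ2 = aeval (spec2 c₀ a t)`. -/
def φ2 (c₀ : Fin m) (a : Fin h → ℂ) (t : ℂ) : R2 m h →ₐ[ℂ] R2 m h := aeval (spec2 c₀ a t)

/-- On the `c₀`-block `φ2` produces the scalar `−t + Σ_{k∈U} a k`. -/
theorem φ2_lin2_self (c₀ : Fin m) (a : Fin h → ℂ) (t : ℂ) (U : Finset (Fin h)) :
    φ2 c₀ a t (lin2 c₀ U) = C (-t + ∑ k ∈ U, a k) := by
  simp only [φ2, lin2, map_add, map_sum, aeval_X, spec2, if_true, Option.elim]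

/-- Off the `c₀`-block `φ2` is the identity on `lin2`. -/
theorem φ2_lin2_ne {c₀ c : Fin m} (hc : c ≠ c₀) (a : Fin h → ℂ) (t : ℂ) (U : Finset (Fin h)) :
    φ2 c₀ a t (lin2 c U) = lin2 c U := by
  simp only [φ2, lin2, map_add, map_sum, aeval_X, spec2, if_neg hc]

/-- Entries after specialisation: columns containing `c₀` acquire the scalar factor `C (−t + Σ a)`. -/
theorem φ2_ssv2_apply (κ : ℕ) (c₀ : Fin m) (a : Fin h → ℂ) (t : ℂ) (u : (Fin κ → Bool) → Finset (Fin h))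
    (w : (Fin κ → Bool) → Finset (Fin m)) (i j : Fin κ → Bool) :
    φ2 c₀ a t (ssv2 κ u w i j) =
      if c₀ ∈ w j then C (-t + ∑ k ∈ u i, a k) * ∏ c ∈ (w j).erase c₀, lin2 c (u i)
      else ∏ c ∈ w j, lin2 c (u i) := by
  simp only [ssv2, map_prod]
  split_ifs with hc
  · rw [← Finset.mul_prod_erase (w j) _ hc, φ2_lin2_self]
    congr 1
    exact Finset.prod_congr rfl fun c hc' => φ2_lin2_ne (Finset.ne_of_mem_erase hc') a t (u i)
  · exact Finset.prod_congr rfl fun c hc' => φ2_lin2_ne (ne_of_mem_of_not_mem hc' hc) a t (u i)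

/-! ## 4. Engine v2 -/

/-- **Engine v2.** Splittable rows × coordinate-halvable columns: the symbolic subset-sum matrix is nonsingular. -/
theorem det_ssv2_ne_zero : ∀ (κ : ℕ) (u : (Fin κ → Bool) → Finset (Fin h)) (w : (Fin κ → Bool) → Finset (Fin m)),
    Function.Injective u → Function.Injective w →
    IsSplittable κ (univ.image u) → IsCoordHalvable κ (univ.image w) → (ssv2 κ u w).det ≠ 0
  | 0, u, w, _, _, _, _ => by
    rw [Matrix.det_unique]
    simp only [ssv2]
    exact Finset.prod_ne_zero_iff.mpr fun c _ => lin2_ne_zero c _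
  | κ + 1, u, w, hu, hw, hs, hcw => by
    obtain ⟨Z, hZ, ⟨a, t, hat⟩, hsZ, hsC⟩ := hs
    obtain ⟨c₀, hW₀card, hW₁card, hW₀, hW₁⟩ := hcw
    -- row split
    set s : (Fin (κ + 1) → Bool) → ℂ := fun i => -t + ∑ k ∈ u i, a k with hs_def
    have hs_iff : ∀ i, s i = 0 ↔ u i ∈ Z := fun i => by
      rw [hs_def]
      simp only
      rw [neg_add_eq_zero, eq_comm]
      exact hat (u i) (mem_image_of_mem u (mem_univ i))
    let pZ : (Fin (κ + 1) → Bool) → Prop := fun i => u i ∈ Z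
    have hcardZ : Fintype.card {i // pZ i} = Fintype.card (Fin κ → Bool) := by
      have himg : (univ.filter fun i => pZ i).image u = Z := by
        ext U
        simp only [mem_image, mem_filter, mem_univ, true_and, pZ]
        constructor
        · rintro ⟨i, hi, rfl⟩; exact hi
        · intro hU
          obtain ⟨i, -, rfl⟩ := mem_image.mp (hZ hU)
          exact ⟨i, hU, rfl⟩
      have hci := card_image_of_injective (univ.filter fun i => pZ i) hu
      rw [himg, hsZ.card_eq] at hci
      rw [Fintype.card_subtype, card_bv]
      exact hci.symm
    have hcardC : Fintype.card {i // ¬ pZ i} = Fintype.card (Fin κ → Bool) := by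
      rw [Fintype.card_subtype_compl, hcardZ, card_bv, card_bv, pow_succ]
      omega
    let e₀ : {i // pZ i} ≃ (Fin κ → Bool) := Fintype.equivOfCardEq hcardZ
    let e₁ : {i // ¬ pZ i} ≃ (Fin κ → Bool) := Fintype.equivOfCardEq hcardC
    let u₀ : (Fin κ → Bool) → Finset (Fin h) := fun j => u (e₀.symm j).1
    let u₁ : (Fin κ → Bool) → Finset (Fin h) := fun j => u (e₁.symm j).1
    have hu₀ : Function.Injective u₀ := fun j j' hjj' => e₀.symm.injective (Subtype.ext (hu hjj'))
    have hu₁ : Function.Injective u₁ := fun j j' hjj' => e₁.symm.injective (Subtype.ext (hu hjj'))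
    have himg₀ : univ.image u₀ = Z := by
      ext U
      simp only [mem_image, mem_univ, true_and, u₀]
      constructor
      · rintro ⟨j, rfl⟩; exact (e₀.symm j).2
      · intro hU
        obtain ⟨i, -, rfl⟩ := mem_image.mp (hZ hU)
        exact ⟨e₀ ⟨i, hU⟩, by simp⟩
    have himg₁ : univ.image u₁ = univ.image u \ Z := by
      ext U
      simp only [mem_image, mem_univ, true_and, u₁, mem_sdiff]
      constructor
      · rintro ⟨j, rfl⟩; exact ⟨⟨_, rfl⟩, (e₁.symm j).2⟩
      · rintro ⟨⟨i, rfl⟩, hU⟩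
        exact ⟨e₁ ⟨i, hU⟩, by simp⟩
    -- column split
    let qW : (Fin (κ + 1) → Bool) → Prop := fun j => c₀ ∈ w j
    have hcardW₀ : Fintype.card {j // ¬ qW j} = Fintype.card (Fin κ → Bool) := by
      have himg : (univ.filter fun j => ¬ qW j).image w = (univ.image w).filter fun W => c₀ ∉ W := by
        ext W
        simp only [mem_image, mem_filter, mem_univ, true_and, qW]
        constructor
        · rintro ⟨j, hj, rfl⟩; exact ⟨⟨j, rfl⟩, hj⟩
        · rintro ⟨⟨j, rfl⟩, hj⟩; exact ⟨j, hj, rfl⟩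
      have hci := card_image_of_injective (univ.filter fun j => ¬ qW j) hw
      rw [himg, hW₀card] at hci
      rw [Fintype.card_subtype, card_bv]
      exact hci.symm
    have hcardW₁ : Fintype.card {j // qW j} = Fintype.card (Fin κ → Bool) := by
      have := Fintype.card_subtype_compl (fun j => qW j)
      rw [hcardW₀, card_bv, card_bv, pow_succ] at this
      rw [card_bv]
      have hpos : 0 < 2 ^ κ := Nat.two_pow_pos κ
      have hle : Fintype.card {j // qW j} ≤ Fintype.card (Fin (κ + 1) → Bool) :=
        Fintype.card_subtype_le _
      rw [card_bv, pow_succ] at hle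
      omega
    let f₀ : {j // ¬ qW j} ≃ (Fin κ → Bool) := Fintype.equivOfCardEq hcardW₀
    let f₁ : {j // qW j} ≃ (Fin κ → Bool) := Fintype.equivOfCardEq hcardW₁
    let w₀ : (Fin κ → Bool) → Finset (Fin m) := fun j => w (f₀.symm j).1
    let w₁ : (Fin κ → Bool) → Finset (Fin m) := fun j => (w (f₁.symm j).1).erase c₀
    have hw₀ : Function.Injective w₀ := fun j j' hjj' => f₀.symm.injective (Subtype.ext (hw hjj'))
    have hw₁ : Function.Injective w₁ := by
      intro j j' hjj'
      apply f₁.symm.injective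
      apply Subtype.ext
      apply hw
      have h1 := Finset.insert_erase (f₁.symm j).2
      have h2 := Finset.insert_erase (f₁.symm j').2
      rw [← h1, ← h2]
      exact congrArg (insert c₀) hjj'
    have himgw₀ : univ.image w₀ = (univ.image w).filter fun W => c₀ ∉ W := by
      ext W
      simp only [mem_image, mem_univ, true_and, w₀, mem_filter]
      constructor
      · rintro ⟨j, rfl⟩; exact ⟨⟨_, rfl⟩, (f₀.symm j).2⟩
      · rintro ⟨⟨i, rfl⟩, hW⟩
        exact ⟨f₀ ⟨i, hW⟩, by simp⟩
    have himgw₁ : univ.image w₁ = ((univ.image w).filter fun W => c₀ ∈ W).image fun W => W.erase c₀ := by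
      ext W
      simp only [mem_image, mem_univ, true_and, w₁, mem_filter]
      constructor
      · rintro ⟨j, rfl⟩; exact ⟨w (f₁.symm j).1, ⟨⟨_, rfl⟩, (f₁.symm j).2⟩, rfl⟩
      · rintro ⟨W', ⟨⟨i, rfl⟩, hW⟩, rfl⟩
        exact ⟨f₁ ⟨i, hW⟩, by simp⟩
    have IH₀ : (ssv2 κ u₀ w₀).det ≠ 0 :=
      det_ssv2_ne_zero κ u₀ w₀ hu₀ hw₀ (himg₀ ▸ hsZ) (himgw₀ ▸ hW₀)
    have IH₁ : (ssv2 κ u₁ w₁).det ≠ 0 :=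
      det_ssv2_ne_zero κ u₁ w₁ hu₁ hw₁ (himg₁ ▸ hsC) (himgw₁ ▸ hW₁)
    -- specialise the `c₀`-block and reindex
    set M' : Matrix (Fin (κ + 1) → Bool) (Fin (κ + 1) → Bool) (R2 m h) :=
      (φ2 c₀ a t).toRingHom.mapMatrix (ssv2 (κ + 1) u w) with hM'
    let θ : ((Fin κ → Bool) ⊕ (Fin κ → Bool)) ≃ (Fin (κ + 1) → Bool) :=
      (Equiv.sumCongr e₀.symm e₁.symm).trans (Equiv.sumCompl pZ)
    have hθl : ∀ j, θ (Sum.inl j) = (e₀.symm j).1 := fun j => by simp [θ, Equiv.sumCompl_apply_inl]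
    have hθr : ∀ j, θ (Sum.inr j) = (e₁.symm j).1 := fun j => by simp [θ, Equiv.sumCompl_apply_inr]
    -- a cleaner column equivalence: left summand = columns avoiding `c₀`
    let δ' : ((Fin κ → Bool) ⊕ (Fin κ → Bool)) ≃ (Fin (κ + 1) → Bool) :=
      (Equiv.sumCongr f₀.symm f₁.symm).trans
        ((Equiv.sumComm _ _).trans (Equiv.sumCompl qW))
    have hδl : ∀ j, δ' (Sum.inl j) = (f₀.symm j).1 := fun j => by
      simp [δ', Equiv.sumCompl_apply_inr]
    have hδr : ∀ j, δ' (Sum.inr j) = (f₁.symm j).1 := fun j => by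
      simp [δ', Equiv.sumCompl_apply_inl]
    let d : (Fin κ → Bool) → R2 m h := fun j => C (s (e₁.symm j).1)
    have hblock : M'.submatrix θ δ' =
        Matrix.fromBlocks (ssv2 κ u₀ w₀) 0
          (fun i j => ∏ c ∈ w₀ j, lin2 c (u₁ i)) (Matrix.diagonal d * ssv2 κ u₁ w₁) := by
      apply Matrix.ext
      intro x y
      rcases x with i | i <;> rcases y with j | j
      · have hj : c₀ ∉ w (f₀.symm j).1 := (f₀.symm j).2
        simp only [Matrix.submatrix_apply, hθl, hδl, Matrix.fromBlocks_apply₁₁, hM',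
          RingHom.mapMatrix_apply, Matrix.map_apply, AlgHom.toRingHom_eq_coe, RingHom.coe_coe,
          φ2_ssv2_apply, if_neg hj]
        rfl
      · have hj : c₀ ∈ w (f₁.symm j).1 := (f₁.symm j).2
        simp only [Matrix.submatrix_apply, hθl, hδr, Matrix.fromBlocks_apply₁₂, hM',
          RingHom.mapMatrix_apply, Matrix.map_apply, AlgHom.toRingHom_eq_coe, RingHom.coe_coe,
          φ2_ssv2_apply, if_pos hj, Matrix.zero_apply]
        have : s (e₀.symm i).1 = 0 := (hs_iff _).mpr (e₀.symm i).2
        rw [show (-t + ∑ k ∈ u (e₀.symm i).1, a k) = s (e₀.symm i).1 from rfl, this]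
        simp
      · have hj : c₀ ∉ w (f₀.symm j).1 := (f₀.symm j).2
        simp only [Matrix.submatrix_apply, hθr, hδl, Matrix.fromBlocks_apply₂₁, hM',
          RingHom.mapMatrix_apply, Matrix.map_apply, AlgHom.toRingHom_eq_coe, RingHom.coe_coe,
          φ2_ssv2_apply, if_neg hj]
        rfl
      · have hj : c₀ ∈ w (f₁.symm j).1 := (f₁.symm j).2
        simp only [Matrix.submatrix_apply, hθr, hδr, Matrix.fromBlocks_apply₂₂, hM',
          RingHom.mapMatrix_apply, Matrix.map_apply, AlgHom.toRingHom_eq_coe, RingHom.coe_coe,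
          φ2_ssv2_apply, if_pos hj, Matrix.diagonal_mul]
        rfl
    have hd : ∀ j, d j ≠ 0 := fun j => by
      simp only [d, ne_eq, C_eq_zero]
      exact fun h0 => (e₁.symm j).2 ((hs_iff _).mp h0)
    have hdet_block : (M'.submatrix θ δ').det ≠ 0 := by
      rw [hblock, Matrix.det_fromBlocks_zero₁₂, Matrix.det_mul, Matrix.det_diagonal]
      exact mul_ne_zero IH₀ (mul_ne_zero (prod_ne_zero_iff.mpr fun j _ => hd j) IH₁)
    have hdetM' : M'.det ≠ 0 := det_ne_zero_of_submatrix M' θ δ' hdet_block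
    intro h0
    apply hdetM'
    rw [hM', ← RingHom.map_det, h0, map_zero]

/-- **Numeric table** (the hypothesis of `AdditiveDoor.partitionMinor_hit_of_additive_mem`, literally). -/
theorem exists_table_det_ne_zero (κ : ℕ) (u : (Fin κ → Bool) → Finset (Fin h))
    (w : (Fin κ → Bool) → Finset (Fin m)) (hu : Function.Injective u) (hw : Function.Injective w)
    (hs : IsSplittable κ (univ.image u)) (hcw : IsCoordHalvable κ (univ.image w)) :
    ∃ (Γ₀ : Fin m → ℂ) (Γ : Fin h → Fin m → ℂ),
      (Matrix.of fun i j : Fin κ → Bool => ∏ c ∈ w j, (Γ₀ c + ∑ k ∈ u i, Γ k c)).det ≠ 0 := by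
  have hne := det_ssv2_ne_zero κ u w hu hw hs hcw
  have : ∃ x : Fin m × Option (Fin h) → ℂ, eval x (ssv2 κ u w).det ≠ 0 := by
    by_contra hcon
    push Not at hcon
    exact hne (MvPolynomial.funext fun x => by rw [hcon x, map_zero])
  obtain ⟨x, hx⟩ := this
  refine ⟨fun c => x (c, none), fun k c => x (c, some k), ?_⟩
  rw [RingHom.map_det] at hx
  have hmat : (eval x).mapMatrix (ssv2 κ u w) =
      Matrix.of fun i j : Fin κ → Bool => ∏ c ∈ w j, (x (c, none) + ∑ k ∈ u i, x (c, some k)) := by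
    ext i j
    simp only [RingHom.mapMatrix_apply, Matrix.map_apply, ssv2, map_prod, Matrix.of_apply]
    refine Finset.prod_congr rfl fun c _ => ?_
    simp [lin2, map_add, map_sum, eval_X]
  rw [hmat] at hx
  exact hx

/-! ## 5. Through the door -/

open Literature.Barriers.ValiantsHypothesis
open Summit.ValiantsHypothesis.ValiantsHypothesis.Theorems.BarrierLever.AdditiveDoor
  (partitionMinor_hit_of_additive_mem partitionMinor_hit_symm)

/-- **SPLITTABLE rows × COORDINATE-HALVABLE columns are hit** (`h ≥ 2`, `b = 5`). -/
theorem partitionMinor_hit_of_isSplittable_isCoordHalvable (hh : 2 ≤ h) {κ : ℕ}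
    (u w : (Fin κ → Bool) → Finset (Fin h)) (hu : Function.Injective u) (hw : Function.Injective w)
    (hs : IsSplittable κ (univ.image u)) (hcw : IsCoordHalvable κ (univ.image w)) :
    ∃ f ∈ SmallCircuits ℂ (h + h) 5,
      (Matrix.of fun i j : Fin κ → Bool => MvPolynomial.coeff
        (∑ a ∈ u i, Finsupp.single (Fin.castAdd h a) 1 +
          ∑ c ∈ w j, Finsupp.single (Fin.natAdd h c) 1) f).det ≠ 0 := by
  obtain ⟨Γ₀, Γ, hdet⟩ := exists_table_det_ne_zero κ u w hu hw hs hcw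
  exact partitionMinor_hit_of_additive_mem h hh u w Γ₀ Γ hdet

/-- The mirror: **COORDINATE-HALVABLE rows × SPLITTABLE columns are hit**. -/
theorem partitionMinor_hit_of_isCoordHalvable_isSplittable (hh : 2 ≤ h) {κ : ℕ}
    (u w : (Fin κ → Bool) → Finset (Fin h)) (hu : Function.Injective u) (hw : Function.Injective w)
    (hcu : IsCoordHalvable κ (univ.image u)) (hs : IsSplittable κ (univ.image w)) :
    ∃ f ∈ SmallCircuits ℂ (h + h) 5,
      (Matrix.of fun i j : Fin κ → Bool => MvPolynomial.coeff
        (∑ a ∈ u i, Finsupp.single (Fin.castAdd h a) 1 +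
          ∑ c ∈ w j, Finsupp.single (Fin.natAdd h c) 1) f).det ≠ 0 :=
  partitionMinor_hit_symm h 5 u w (partitionMinor_hit_of_isSplittable_isCoordHalvable hh w u hw hu hs hcu)

end

end Summit.ValiantsHypothesis.ValiantsHypothesis.Theorems.BarrierLever.SubsetSum
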